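import Summits.RiemannHypothesis.RiemannHypothesis.Theorems.SignConeSignConeOscillatoryDensityAssembly
import Summits.RiemannHypothesis.RiemannHypothesis.Theorems.SignConeSignConeOscillatoryIffInequality
import Summits.RiemannHypothesis.RiemannHypothesis.Theorems.SignConeSignConeOscillatoryStubExtremalExistsValue
import Summits.RiemannHypothesis.RiemannHypothesis.Theorems.SignConeSignConeDualityStubSlater
import Summits.RiemannHypothesis.RiemannHypothesis.Theorems.SignConeSignConeDualityStubFarNode
import Summits.RiemannHypothesis.RiemannHypothesis.Theorems.SignConeSignConeDualityStubArchPolarAdd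
import Summits.RiemannHypothesis.RiemannHypothesis.Theorems.SignConeSignConeDualityStubScaling

/-!
# Crux `SignCone.SignConeOscillatory` (stmt-RiemannHypothesis-16302), line `dual_witness`:
# X₂ ⟸ crux — the KKT split is an EQUIVALENCE

Line `dual_witness` splits the crux as X₁ ∧ X₂ → crux with X₁ (`SignConeExtremalExists`, KKT-extremal configurations
exist; PROVED, p152068) and X₂ (`SignConeExtremalNonneg`: every KKT-extremal configuration `(μ, N, c, f)` has `μ ≥ 0`).
Here we prove the converse direction

* `extremalNonneg_of_crux : SignConeOscillatory → ∀ a μ, 0 < a → ∀ N c f, IsExtremalKKT a μ N c f → 0 ≤ μ`,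

so that, unconditionally, **X₂ ↔ SignConeOscillatory** (↔ the route target `SignConeInequality`, p129083): the line
buys STRUCTURE (one `L²` extremal per cutoff, fake primes complementary to its node values), not strength.

Proof.  `μ = reWar (f ⋆ f̃) + 1` for the `L²` extremal `f` (clause (ii)), which has finite archimedean energy; by the
density-in-energy lemma (`exists_test_seq_of_finite_energy`, parts I–IV) there are tests `Gⱼ` on the window with
`Gⱼ → f` in `L²`, `∫|Gⱼ|² → 1` and `reWar (Gⱼ ⋆ G̃ⱼ) → reWar (f ⋆ f̃)`.  The kernels `Gⱼ ⋆ G̃ⱼ` need not be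
node-nonnegative, but `f ⋆ f̃` is, and adding `δ · (s ⋆ s̃)` for the Slater bump `s` of `SignConeDuality`
(`stub_slater`: strictly positive at every active node) repairs the finitely many active node signs for `j` large;
the crux (as `SignConeInequality`) applied to the two-element family `(Gⱼ, √δ s)` gives
`-(∫|Gⱼ|² + δ Re (s⋆s̃)(0)) ≤ reWar (Gⱼ ⋆ G̃ⱼ) + δ reWar (s ⋆ s̃)`; let `j → ∞`, then `δ → 0⁺`: `-1 ≤ μ - 1`.
-/

noncomputable section

-- `Summit.RiemannHypothesis.RiemannHypothesis.…` repeats a namespace component by design (D-0017 layout).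
set_option linter.dupNamespace false

open scoped BigOperators ComplexConjugate Topology ENNReal
open MeasureTheory Set Filter Complex

namespace Summit.RiemannHypothesis.RiemannHypothesis.Theorems.SignCone.DualWitness

open Literature.NumberTheory.LFunctions
open Summit.RiemannHypothesis.RiemannHypothesis.Theses.SignCone
open Summit.RiemannHypothesis.RiemannHypothesis.Theorems.SignCone
open Summit.RiemannHypothesis.RiemannHypothesis.Theorems.SignConeDuality

/-! ## Two-element families: a kernel plus `δ` times the Slater kernel -/

/-- The autocorrelation sum of the family `(G, √δ · s)` is `G ⋆ G̃ + δ · (s ⋆ s̃)`. [folklore] -/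
theorem coneSum_pair (G s : ℝ → ℂ) {δ : ℝ} (hδ : 0 ≤ δ) :
    coneSum 2 ![G, fun t => (Real.sqrt δ : ℂ) * s t] = fun t => autocorr G t + (δ : ℂ) * autocorr s t := by
  funext t
  simp only [coneSum, Fin.sum_univ_two, Matrix.cons_val_zero, Matrix.cons_val_one]
  rw [autocorr_real_mul, Real.sq_sqrt hδ]

/-- `reWar (G ⋆ G̃ + δ · (s ⋆ s̃)) = reWar (G ⋆ G̃) + δ · reWar (s ⋆ s̃)` for Weil tests `G, s` (additivity and
homogeneity of the prime-free Weil form on test kernels). [folklore] -/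
theorem reWar_autocorr_add_smul {G s : ℝ → ℂ} (hG : IsWeilTest G) (hs : IsWeilTest s) (δ : ℝ) :
    reWar (fun t => autocorr G t + (δ : ℂ) * autocorr s t) = reWar (autocorr G) + δ * reWar (autocorr s) := by
  have h1 : IsWeilTest (autocorr G) := by rw [autocorr_eq_weilConv]; exact hG.weilConv hG.weilReflect
  have h2 : IsWeilTest (fun t => (δ : ℂ) * autocorr s t) := by
    rw [autocorr_eq_weilConv]; exact (hs.weilConv hs.weilReflect).const_mul _
  have e : (fun t => autocorr G t + (δ : ℂ) * autocorr s t) = autocorr G + fun t => (δ : ℂ) * autocorr s t := by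
    funext t; rfl
  rw [reWar_eq, e, stub_archPolarAdd _ _ h1 h2, Complex.add_re, stub_scaling (δ : ℂ) (autocorr s), re_ofReal_mul,
    ← reWar_eq, ← reWar_eq]

/-! ## The theorem -/

/-- **X₂ ⟸ crux** (line `dual_witness` of crux `SignConeOscillatory`, stmt-RiemannHypothesis-16302): under the crux, every
KKT-extremal configuration has nonnegative value.  With the landed `signConeOscillatory_of_extremalNonneg` this makes
`SignConeExtremalNonneg ↔ SignConeOscillatory` unconditional.  See the module docstring for the proof
(density in energy + Slater node repair + `j → ∞`, `δ → 0⁺`). [folklore] -/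
theorem extremalNonneg_of_crux : SignConeOscillatory → ∀ a μ : ℝ, 0 < a → ∀ (N : ℕ) (c : ℕ → ℝ) (f : ℝ → ℂ), IsExtremalKKT a μ N c f → 0 ≤ μ := by
  intro hcrux a μ ha N c f hK
  obtain ⟨-, -, -, ⟨hf2, hfs, hf0, hfnodes, hfE, hval⟩, -, -⟩ := hK
  have hI : SignConeInequality := signConeOscillatory_iff_signConeInequality.mp hcrux
  -- density in energy
  obtain ⟨G, hG, hGL2, hN, hW⟩ := exists_test_seq_of_finite_energy ha hf2 hfs hfE
  have hG2 : ∀ j, MemLp (G j) 2 volume := fun j => (hG j).1.1.continuous.memLp_of_hasCompactSupport (hG j).1.2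
  have hf1 : ∫ x, ‖f x‖ ^ 2 = 1 := by rw [← autocorr_zero_re]; exact hf0
  rw [hf1] at hN
  -- the Slater kernel
  obtain ⟨s, hs, hssupp, hspos⟩ := stub_slater a ha
  set S : ℝ → ℂ := autocorr s with hSdef
  -- for every `δ > 0`: `-(1 + δ Re S(0)) ≤ (μ - 1) + δ reWar S`
  have hδ : ∀ δ : ℝ, 0 < δ → -(1 + δ * (S 0).re) ≤ (μ - 1) + δ * reWar S := by
    intro δ hδ
    -- node repair: eventually all active nodes of `Gⱼ ⋆ G̃ⱼ + δ S` are nonnegative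
    set A : Finset ℕ := Finset.Ico 2 ⌈Real.exp (2 * a)⌉₊ with hA
    have hev : ∀ᶠ j in atTop, ∀ n ∈ A, 0 ≤ (autocorr (G j) (Real.log n)).re + δ * (S (Real.log n)).re := by
      refine (A.eventually_all).2 fun n hn => ?_
      obtain ⟨hn2, hnN⟩ := Finset.mem_Ico.1 hn
      have hSn : 0 < (S (Real.log n)).re := by
        rw [hSdef, autocorr_eq_weilConv]; exact hspos n hn2 (log_lt_two_mul_of_lt_ceil (by omega) hnN)
      have hlim : Tendsto (fun j => (autocorr (G j) (Real.log n)).re + δ * (S (Real.log n)).re) atTop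
          (𝓝 ((autocorr f (Real.log n)).re + δ * (S (Real.log n)).re)) :=
        ((continuous_re.tendsto _).comp (tendsto_autocorr hG2 hf2 hGL2 (Real.log n))).add tendsto_const_nhds
      have hpos : 0 < (autocorr f (Real.log n)).re + δ * (S (Real.log n)).re := by
        have := hfnodes n hn2; positivity
      exact (tendsto_order.1 hlim).1 0 hpos |>.mono fun j hj => hj.le
    -- the crux inequality along the sequence, eventually
    have hineq : ∀ᶠ j in atTop, -((∫ x, ‖G j x‖ ^ 2) + δ * (S 0).re) ≤ reWar (autocorr (G j)) + δ * reWar S := by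
      filter_upwards [hev] with j hj
      set gfam : Fin 2 → ℝ → ℂ := ![G j, fun t => (Real.sqrt δ : ℂ) * s t] with hgfam
      have hfam : ∀ i, IsWeilTest (gfam i) ∧ tsupport (gfam i) ⊆ Icc (-a) a := by
        intro i
        fin_cases i
        · exact ⟨(hG j).1, (hG j).2⟩
        · exact ⟨hs.const_mul _, (tsupport_mul_subset_right (f := fun _ : ℝ => (Real.sqrt δ : ℂ)) (g := s)).trans hssupp⟩
      have hsum : coneSum 2 gfam = fun t => autocorr (G j) t + (δ : ℂ) * S t := coneSum_pair (G j) s hδ.le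
      have hnodes : ∀ n : ℕ, 2 ≤ n → 0 ≤ (coneSum 2 gfam (Real.log n)).re := by
        intro n hn2
        rw [hsum]
        simp only [add_re, re_ofReal_mul]
        by_cases hnN : n < ⌈Real.exp (2 * a)⌉₊
        · exact hj n (Finset.mem_Ico.2 ⟨hn2, hnN⟩)
        · push Not at hnN
          have hlog : 2 * a ≤ Real.log n := two_mul_le_log_of_ceil_le (by omega) hnN
          have h1 : autocorr (G j) (Real.log n) = 0 := by
            rw [autocorr_eq_weilConv]; exact stub_farNode a (G j) (hG j).1 (hG j).2 _ hlog
          have h2 : S (Real.log n) = 0 := by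
            rw [hSdef, autocorr_eq_weilConv]; exact stub_farNode a s hs hssupp _ hlog
          rw [h1, h2]; simp
      have key : -(coneSum 2 gfam 0).re ≤ reWar (coneSum 2 gfam) :=
        hI a ha 2 gfam (fun i => ⟨(hfam i).1, (hfam i).2⟩) hnodes
      rw [hsum, reWar_autocorr_add_smul (hG j).1 hs δ] at key
      simp only [add_re, re_ofReal_mul, autocorr_zero_re] at key
      rw [hSdef] at key ⊢
      exact key
    -- pass to the limit `j → ∞`
    have hl : Tendsto (fun j => -((∫ x, ‖G j x‖ ^ 2) + δ * (S 0).re)) atTop (𝓝 (-(1 + δ * (S 0).re))) :=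
      (hN.add tendsto_const_nhds).neg
    have hr : Tendsto (fun j => reWar (autocorr (G j)) + δ * reWar S) atTop (𝓝 ((μ - 1) + δ * reWar S)) := by
      have e : reWar (autocorr f) = μ - 1 := by linarith
      rw [← e]
      exact hW.add tendsto_const_nhds
    exact le_of_tendsto_of_tendsto hl hr hineq
  -- let `δ → 0⁺`
  by_contra hμ
  push Not at hμ
  set K : ℝ := |(S 0).re| + |reWar S| + 1 with hKdef
  have hK0 : 0 < K := by positivity
  have h := hδ (-μ / (2 * K)) (by apply div_pos (by linarith) (by positivity))
  -- `-(1 + δ S₀) ≤ μ - 1 + δ W` with `δ = -μ/(2K)` gives `-μ ≤ δ (S₀ + W) ≤ δ · K < -μ/2… ` contradiction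
  have hbound : -μ / (2 * K) * (S 0).re + -μ / (2 * K) * reWar S ≤ -μ / (2 * K) * K := by
    rw [← mul_add]
    refine mul_le_mul_of_nonneg_left ?_ (by apply div_nonneg (by linarith) (by positivity))
    rw [hKdef]
    linarith [le_abs_self (S 0).re, le_abs_self (reWar S)]
  have e : -μ / (2 * K) * K = -μ / 2 := by field_simp
  rw [e] at hbound
  linarith

end Summit.RiemannHypothesis.RiemannHypothesis.Theorems.SignCone.DualWitness

end
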